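import Summits.KontsevichZagierPeriods.KontsevichZagierPeriods.Theses.FurushoPentagon
import Literature.NumberTheory.Transcendental.KZCubicalCalculus
import Literature.RingTheory.MvPowerSeries.ConvergentPowerSeries
import Literature.RingTheory.MvPowerSeries.EvalAnalytic
import Mathlib.Analysis.Calculus.SmoothSeries
import Mathlib.Analysis.Calculus.Deriv.Pi
import Mathlib.Analysis.Calculus.Deriv.Pow
import Mathlib.Analysis.Calculus.Deriv.Mul
import Mathlib.Analysis.Calculus.Deriv.Comp
import Mathlib.Analysis.Calculus.FDeriv.Analytic
import Mathlib.Algebra.Order.Ring.Pow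

/-!
# `SectorToKernel`, line `effective-cube-surjection`: convergent real power series are
real-analytic near the closed cube, with termwise partial derivatives (stub S3b)

Stub `stub_analyticOfSummable` of the crux `FurushoPentagon.SectorToKernel`
(stmt-KontsevichZagierPeriods-10813). For a real power series `R` in `M` variables with summable
majorant `∑ₐ |Rₐ| ρ^{|a|} < ∞` of polyradius `ρ > 1` we produce `H := eval R`, the sum function of
`Literature/RingTheory/MvPowerSeries/ConvergentPowerSeries.lean`, and prove:

* `H` is real-analytic at every point of the closed unit cube `[0,1]ᴹ` — the cube lies in the open
  polydisc of polyradius `ρ`, on which `eval R` is analytic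
  (`Literature/RingTheory/MvPowerSeries/EvalAnalytic.lean`, `analyticAt_eval`);
* `H x = ∑ₐ Rₐ xᵃ` on the cube (`hasSum_eval`);
* **termwise partial derivatives**: `∂ᵢH(x) = ∑ₐ (aᵢ + 1) R_{a + eᵢ} xᵃ` on the cube. Along the
  coordinate line `t ↦ (x with xᵢ ↦ t)` the series is a series of functions
  `t ↦ Rₐ t^{aᵢ} ∏_{j ≠ i} xⱼ^{aⱼ}` whose derivatives are dominated on `(-r, r)`, `1 < r < ρ`, by the
  summable family `|Rₐ| |a| r^{|a|}` (Bernoulli: `n rⁿ ≤ r/(ρ-r) · ρⁿ`), so it may be differentiated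
  termwise (`hasDerivAt_tsum_of_isPreconnected`); the derivative of the line function is
  `fderiv ℝ H x (Pi.single i 1)` by the chain rule (`H` is differentiable, being analytic), and the
  reindexing `a = b + eᵢ` (terms with `aᵢ = 0` vanish) gives the registered form.

References: S. G. Krantz, H. R. Parks, *A Primer of Real Analytic Functions* (2002), Prop. 2.2.3,
§2.2; H. Grauert, R. Remmert, *Analytische Stellenalgebren* (1971), Kap. I §§1–3; folklore.
-/

noncomputable section

namespace Summit.KontsevichZagierPeriods.FurushoPentagon.SectorToKernel

section Helpers

open Set Filter
open MvPowerSeries (coeff)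
open Literature.RingTheory.MvPowerSeries
open Literature.NumberTheory.Transcendental
open scoped NNReal ENNReal Topology

/-! ## The weighted norm at a constant polyradius -/

/-- The total degree `|a| = ∑ᵢ aᵢ` written as a `Finsupp.sum` is `Finsupp.degree a`. [folklore] -/
theorem aos_sum_eq_degree {σ : Type*} (a : σ →₀ ℕ) : (a.sum fun _ e => e) = a.degree := rfl

/-- A summable majorant `∑ₐ |Rₐ| ρ^{|a|} < ∞` gives a finite weighted norm `‖R‖_r < ∞` at every
constant polyradius `r ≤ ρ`. [folklore] -/
theorem aos_wnorm_lt_top {M : ℕ} {R : MvPowerSeries (Fin M) ℝ} {ρ : ℝ} {r : ℝ≥0}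
    (hr : (r : ℝ) ≤ ρ)
    (hR : Summable fun a : Fin M →₀ ℕ => |coeff a R| * ρ ^ (a.sum fun _ e => e)) :
    wnorm (fun _ : Fin M => r) R < ⊤ := by
  have h1 : Summable fun a : Fin M →₀ ℕ =>
      ((‖coeff a R‖₊ * wt (fun _ : Fin M => r) a : ℝ≥0) : ℝ) := by
    refine Summable.of_nonneg_of_le (fun a => NNReal.coe_nonneg _) (fun a => ?_) hR
    rw [wt_const, NNReal.coe_mul, coe_nnnorm, Real.norm_eq_abs, NNReal.coe_pow,
      ← aos_sum_eq_degree]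
    exact mul_le_mul_of_nonneg_left (pow_le_pow_left₀ r.coe_nonneg hr _) (abs_nonneg _)
  rw [wnorm, lt_top_iff_ne_top, ENNReal.tsum_coe_ne_top_iff_summable]
  exact NNReal.summable_coe.1 h1

/-- Points of the closed unit cube lie in the closed unit polydisc. [folklore] -/
theorem aos_nnnorm_le_one_of_mem_cube {M : ℕ} {x : Fin M → ℝ} (hx : x ∈ KZ.cube M) (i : Fin M) :
    ‖x i‖₊ ≤ (1 : ℝ≥0) := by
  have h := KZ.mem_cube.1 hx i
  rw [← NNReal.coe_le_coe, coe_nnnorm, NNReal.coe_one, Real.norm_eq_abs, abs_le]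
  exact ⟨by linarith [h.1], h.2⟩

/-- `|xⱼ| ≤ 1` on the closed unit cube. [folklore] -/
theorem aos_abs_le_one_of_mem_cube {M : ℕ} {x : Fin M → ℝ} (hx : x ∈ KZ.cube M) (j : Fin M) :
    |x j| ≤ 1 := by
  have h := KZ.mem_cube.1 hx j
  rw [abs_le]
  exact ⟨by linarith [h.1], h.2⟩

/-! ## Analyticity and summation on the cube -/

/-- **The sum `eval R` of a real power series with summable majorant of polyradius `ρ > 1` is
real-analytic at every point of the closed unit cube** (the cube lies in the open polydisc of
polyradius `ρ`, where `eval R` is analytic: `analyticAt_eval`).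
[Krantz–Parks 2002, Prop. 2.2.3; folklore] -/
theorem aos_analyticOnNhd_eval {M : ℕ} {R : MvPowerSeries (Fin M) ℝ} {ρ : ℝ} (hρ : 1 < ρ)
    (hR : Summable fun a : Fin M →₀ ℕ => |coeff a R| * ρ ^ (a.sum fun _ e => e)) :
    AnalyticOnNhd ℝ (eval R) (KZ.cube M) := by
  have h0 : 0 ≤ ρ := (zero_lt_one.trans hρ).le
  have hP : wnorm (fun _ : Fin M => ρ.toNNReal) R < ⊤ :=
    aos_wnorm_lt_top (by rw [Real.coe_toNNReal ρ h0]) hR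
  intro x hx
  refine analyticAt_eval hP fun i => lt_of_le_of_lt (aos_nnnorm_le_one_of_mem_cube hx i) ?_
  rw [← NNReal.coe_lt_coe, NNReal.coe_one, Real.coe_toNNReal ρ h0]
  exact hρ

/-- On the closed unit cube `eval R x = ∑ₐ Rₐ xᵃ`, absolutely convergent. [folklore] -/
theorem aos_hasSum_eval {M : ℕ} {R : MvPowerSeries (Fin M) ℝ} {ρ : ℝ} (hρ : 1 ≤ ρ)
    (hR : Summable fun a : Fin M →₀ ℕ => |coeff a R| * ρ ^ (a.sum fun _ e => e))
    {x : Fin M → ℝ} (hx : x ∈ KZ.cube M) :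
    HasSum (fun a : Fin M →₀ ℕ => coeff a R * a.prod (fun j e => x j ^ e)) (eval R x) :=
  hasSum_eval (ρ := fun _ => (1 : ℝ≥0)) (aos_nnnorm_le_one_of_mem_cube hx)
    (aos_wnorm_lt_top (by rw [NNReal.coe_one]; exact hρ) hR)

/-! ## Termwise partial derivatives -/

/-- Along the `i`-th coordinate line through `x` a monomial splits as
`(x with xᵢ ↦ t)ᵃ = t^{aᵢ} ∏_{j ≠ i} xⱼ^{aⱼ}`. [folklore] -/
theorem aos_mono_update {M : ℕ} (x : Fin M → ℝ) (i : Fin M) (t : ℝ) (a : Fin M →₀ ℕ) :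
    mono (Function.update x i t) a = t ^ (a i) * ∏ j ∈ Finset.univ.erase i, x j ^ (a j) := by
  rw [mono, Finsupp.prod_fintype _ _ (fun j => pow_zero _),
    ← Finset.mul_prod_erase Finset.univ _ (Finset.mem_univ i), Function.update_self]
  congr 1
  exact Finset.prod_congr rfl fun j hj => by
    rw [Function.update_of_ne (Finset.ne_of_mem_erase hj)]

/-- `xᵇ = xᵢ^{bᵢ} ∏_{j ≠ i} xⱼ^{bⱼ}`. [folklore] -/
theorem aos_mono_eq_mul_prod_erase {M : ℕ} (x : Fin M → ℝ) (i : Fin M) (b : Fin M →₀ ℕ) :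
    mono x b = x i ^ (b i) * ∏ j ∈ Finset.univ.erase i, x j ^ (b j) := by
  conv_lhs => rw [← Function.update_eq_self i x]
  exact aos_mono_update x i (x i) b

/-- Bernoulli: `n rⁿ ≤ r/(ρ - r) · ρⁿ` for `0 < r < ρ`. [folklore] -/
theorem aos_nat_mul_pow_le {r ρ : ℝ} (hr : 0 < r) (hrρ : r < ρ) (n : ℕ) :
    (n : ℝ) * r ^ n ≤ r / (ρ - r) * ρ ^ n := by
  set s : ℝ := ρ / r with hs_def
  have hρ : ρ = s * r := by rw [hs_def, div_mul_cancel₀ ρ hr.ne']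
  have hs1 : 0 ≤ s - 1 := by
    rw [sub_nonneg, hs_def, one_le_div hr]
    exact hrρ.le
  have h1 : (n : ℝ) * (s - 1) ≤ s ^ n := by
    have h := one_add_mul_le_pow (a := s - 1) (by linarith) n
    rw [add_sub_cancel] at h
    linarith
  have key : (n : ℝ) * r ^ n * (ρ - r) ≤ r * ρ ^ n := by
    rw [hρ, mul_pow]
    have h2 : (n : ℝ) * r ^ n * (s * r - r) = (n * (s - 1)) * (r ^ n * r) := by ring
    have h3 : r * (s ^ n * r ^ n) = s ^ n * (r ^ n * r) := by ring
    rw [h2, h3]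
    exact mul_le_mul_of_nonneg_right h1 (by positivity)
  rw [div_mul_eq_mul_div, le_div_iff₀ (sub_pos.2 hrρ)]
  exact key

/-- The majorant of the termwise derivatives is summable: `∑ₐ |Rₐ| |a| r^{|a|} < ∞` for
`0 < r < ρ`. [folklore] -/
theorem aos_summable_degree_mul {M : ℕ} {R : MvPowerSeries (Fin M) ℝ} {ρ r : ℝ} (hr : 0 < r)
    (hrρ : r < ρ) (hR : Summable fun a : Fin M →₀ ℕ => |coeff a R| * ρ ^ (a.sum fun _ e => e)) :
    Summable fun a : Fin M →₀ ℕ => |coeff a R| * ((a.degree : ℝ) * r ^ a.degree) := by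
  refine Summable.of_nonneg_of_le
    (fun a => mul_nonneg (abs_nonneg _) (mul_nonneg (Nat.cast_nonneg _) (pow_nonneg hr.le _)))
    (fun a => ?_) (hR.mul_left (r / (ρ - r)))
  rw [aos_sum_eq_degree]
  calc |coeff a R| * ((a.degree : ℝ) * r ^ a.degree)
      ≤ |coeff a R| * (r / (ρ - r) * ρ ^ a.degree) :=
        mul_le_mul_of_nonneg_left (aos_nat_mul_pow_le hr hrρ _) (abs_nonneg _)
    _ = r / (ρ - r) * (|coeff a R| * ρ ^ a.degree) := by ring

/-- **Termwise differentiation along a coordinate line.** For `x` in the closed unit cube and a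
coordinate `i`, the partial derivative `∂ᵢ (eval R) (x)` is the sum of the termwise derivatives
`Rₐ · aᵢ xᵢ^{aᵢ-1} ∏_{j≠i} xⱼ^{aⱼ}`. [Krantz–Parks 2002, Prop. 2.2.3; folklore] -/
theorem aos_hasSum_fderiv_raw {M : ℕ} {R : MvPowerSeries (Fin M) ℝ} {ρ : ℝ} (hρ : 1 < ρ)
    (hR : Summable fun a : Fin M →₀ ℕ => |coeff a R| * ρ ^ (a.sum fun _ e => e))
    {x : Fin M → ℝ} (hx : x ∈ KZ.cube M) (i : Fin M) :
    HasSum (fun a : Fin M →₀ ℕ => coeff a R *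
        ((a i : ℝ) * x i ^ (a i - 1) * ∏ j ∈ Finset.univ.erase i, x j ^ (a j)))
      (fderiv ℝ (eval R) x (Pi.single i 1)) := by
  -- a radius strictly between `1` and `ρ`
  obtain ⟨r, hr1, hrρ⟩ : ∃ r : ℝ, 1 < r ∧ r < ρ := exists_between hρ
  have hr0 : 0 < r := one_pos.trans hr1
  -- the constant cofactors `∏_{j ≠ i} xⱼ^{aⱼ}`
  obtain ⟨K, hK⟩ : ∃ K : (Fin M →₀ ℕ) → ℝ, ∀ a, K a = ∏ j ∈ Finset.univ.erase i, x j ^ (a j) :=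
    ⟨_, fun _ => rfl⟩
  have hKle : ∀ a, |K a| ≤ 1 := fun a => by
    rw [hK, Finset.abs_prod]
    exact Finset.prod_le_one (fun j _ => abs_nonneg _) fun j _ => by
      rw [abs_pow]
      exact pow_le_one₀ (abs_nonneg _) (aos_abs_le_one_of_mem_cube hx j)
  -- the summable majorant of the termwise derivatives on `(-r, r)`
  have hu : Summable fun a : Fin M →₀ ℕ => |coeff a R| * ((a.degree : ℝ) * r ^ a.degree) :=
    aos_summable_degree_mul hr0 hrρ hR
  -- the terms along the line and their derivatives
  have hg : ∀ (a : Fin M →₀ ℕ) (t : ℝ), t ∈ Ioo (-r) r →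
      HasDerivAt (fun t => coeff a R * mono (Function.update x i t) a)
        (coeff a R * ((a i : ℝ) * t ^ (a i - 1) * K a)) t := by
    intro a t _
    have : (fun t => coeff a R * mono (Function.update x i t) a) =
        fun t => coeff a R * (t ^ (a i) * K a) :=
      funext fun t => by rw [aos_mono_update, hK]
    rw [this]
    exact ((hasDerivAt_pow (a i) t).mul_const (K a)).const_mul (coeff a R)
  have hg' : ∀ (a : Fin M →₀ ℕ) (t : ℝ), t ∈ Ioo (-r) r →
      ‖coeff a R * ((a i : ℝ) * t ^ (a i - 1) * K a)‖ ≤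
        |coeff a R| * ((a.degree : ℝ) * r ^ a.degree) := by
    intro a t ht
    have ht' : |t| ≤ r := (abs_lt.2 ht).le
    rw [Real.norm_eq_abs, abs_mul]
    refine mul_le_mul_of_nonneg_left ?_ (abs_nonneg _)
    rw [abs_mul, abs_mul, abs_pow, Nat.abs_cast]
    have hai : (a i : ℝ) ≤ a.degree := by exact_mod_cast Finsupp.le_degree i a
    have hpow : |t| ^ (a i - 1) ≤ r ^ a.degree :=
      (pow_le_pow_left₀ (abs_nonneg t) ht' _).trans
        (pow_le_pow_right₀ hr1.le ((Nat.sub_le _ _).trans (Finsupp.le_degree i a)))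
    calc (a i : ℝ) * |t| ^ (a i - 1) * |K a|
        ≤ (a i : ℝ) * |t| ^ (a i - 1) * 1 :=
          mul_le_mul_of_nonneg_left (hKle a) (by positivity)
      _ = (a i : ℝ) * |t| ^ (a i - 1) := mul_one _
      _ ≤ (a.degree : ℝ) * r ^ a.degree :=
          mul_le_mul hai hpow (by positivity) (by positivity)
  have hxi : x i ∈ Ioo (-r) r := by
    have h := KZ.mem_cube.1 hx i
    exact ⟨by linarith [h.1], by linarith [h.2]⟩
  have hg0 : Summable fun a : Fin M →₀ ℕ => coeff a R * mono (Function.update x i (x i)) a := by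
    rw [Function.update_eq_self]
    exact summable_term (ρ := fun _ => (1 : ℝ≥0)) (aos_nnnorm_le_one_of_mem_cube hx)
      (aos_wnorm_lt_top (by rw [NNReal.coe_one]; exact hρ.le) hR)
  -- termwise differentiation of the series along the line
  have hD : HasDerivAt (fun t => ∑' a : Fin M →₀ ℕ, coeff a R * mono (Function.update x i t) a)
      (∑' a : Fin M →₀ ℕ, coeff a R * ((a i : ℝ) * x i ^ (a i - 1) * K a)) (x i) :=
    hasDerivAt_tsum_of_isPreconnected hu isOpen_Ioo isPreconnected_Ioo hg hg' hxi hg0 hxi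
  -- the same line function through the Fréchet derivative of `eval R` (chain rule)
  have hA : AnalyticAt ℝ (eval R) x := aos_analyticOnNhd_eval hρ hR x hx
  have hD' : HasDerivAt (fun t => ∑' a : Fin M →₀ ℕ, coeff a R * mono (Function.update x i t) a)
      (fderiv ℝ (eval R) x (Pi.single i 1)) (x i) :=
    hA.differentiableAt.hasFDerivAt.comp_hasDerivAt_of_eq (x i) (hasDerivAt_update x i (x i))
      (Function.update_eq_self i x).symm
  rw [hD'.unique hD]
  have hs : Summable fun a : Fin M →₀ ℕ => coeff a R * ((a i : ℝ) * x i ^ (a i - 1) * K a) :=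
    hu.of_norm_bounded fun a => hg' a (x i) hxi
  simp only [hK] at hs ⊢
  exact hs.hasSum

/-- The reindexed term: for `a = b + eᵢ`,
`Rₐ · aᵢ xᵢ^{aᵢ-1} ∏_{j≠i} xⱼ^{aⱼ} = (bᵢ + 1) R_{b+eᵢ} xᵇ`. [folklore] -/
theorem aos_reindex_term {M : ℕ} (R : MvPowerSeries (Fin M) ℝ) (x : Fin M → ℝ) (i : Fin M)
    (b : Fin M →₀ ℕ) :
    coeff (b + Finsupp.single i 1) R * ((((b + Finsupp.single i 1 : Fin M →₀ ℕ) i : ℕ) : ℝ) *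
        x i ^ ((b + Finsupp.single i 1 : Fin M →₀ ℕ) i - 1) *
        ∏ j ∈ Finset.univ.erase i, x j ^ ((b + Finsupp.single i 1 : Fin M →₀ ℕ) j)) =
      ((b i : ℝ) + 1) * coeff (b + Finsupp.single i 1) R * b.prod (fun j e => x j ^ e) := by
  have hi : (b + Finsupp.single i 1 : Fin M →₀ ℕ) i = b i + 1 := by
    rw [Finsupp.add_apply, Finsupp.single_eq_same]
  have hK : ∏ j ∈ Finset.univ.erase i, x j ^ ((b + Finsupp.single i 1 : Fin M →₀ ℕ) j) =
      ∏ j ∈ Finset.univ.erase i, x j ^ (b j) :=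
    Finset.prod_congr rfl fun j hj => by
      rw [Finsupp.add_apply, Finsupp.single_eq_of_ne (Finset.ne_of_mem_erase hj), add_zero]
  rw [hi, hK, Nat.add_sub_cancel, Nat.cast_succ,
    show (b.prod fun j e => x j ^ e) = mono x b from rfl, aos_mono_eq_mul_prod_erase x i b]
  ring

/-- **Termwise partial derivatives in registered form**: on the closed unit cube
`∂ᵢ (eval R) (x) = ∑_b (bᵢ + 1) R_{b + eᵢ} xᵇ` (reindex `a = b + eᵢ` in `aos_hasSum_fderiv_raw`;
the terms with `aᵢ = 0` vanish). [Krantz–Parks 2002, Prop. 2.2.3; folklore] -/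
theorem aos_hasSum_fderiv {M : ℕ} {R : MvPowerSeries (Fin M) ℝ} {ρ : ℝ} (hρ : 1 < ρ)
    (hR : Summable fun a : Fin M →₀ ℕ => |coeff a R| * ρ ^ (a.sum fun _ e => e))
    {x : Fin M → ℝ} (hx : x ∈ KZ.cube M) (i : Fin M) :
    HasSum (fun a : Fin M →₀ ℕ => ((a i : ℝ) + 1) * coeff (a + Finsupp.single i 1) R *
      a.prod (fun j e => x j ^ e)) (fderiv ℝ (eval R) x (Pi.single i 1)) := by
  have h := aos_hasSum_fderiv_raw hρ hR hx i
  have hinj : Function.Injective fun b : Fin M →₀ ℕ => b + Finsupp.single i 1 :=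
    add_left_injective _
  have hzero : ∀ a ∉ Set.range (fun b : Fin M →₀ ℕ => b + Finsupp.single i 1),
      coeff a R * ((a i : ℝ) * x i ^ (a i - 1) * ∏ j ∈ Finset.univ.erase i, x j ^ (a j)) = 0 := by
    intro a ha
    have hai : a i = 0 := by
      by_contra hne
      exact ha ⟨a - Finsupp.single i 1,
        tsub_add_cancel_of_le (Finsupp.single_le_iff.2 (Nat.one_le_iff_ne_zero.2 hne))⟩
    rw [hai, Nat.cast_zero, zero_mul, zero_mul, mul_zero]
  have h2 := (hinj.hasSum_iff hzero).2 h
  convert h2 using 1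
  funext b
  exact (aos_reindex_term R x i b).symm

end Helpers

open Set MeasureTheory
open Literature.NumberTheory.Transcendental
open Literature.NumberTheory.Transcendental.KZ hiding cubicalSpan
open Summit.KontsevichZagierPeriods.KontsevichZagierPeriods.Theses.FurushoPentagon

/-- **S3b (convergent real power series are real-analytic near the closed cube, with termwise
partial derivatives).** A real power series `R` in `M` variables with `∑ₐ |Rₐ| ρ^{|a|} < ∞` for some
`ρ > 1` has a sum `H` (`= eval R`) which is real-analytic at every point of the closed unit cube,
with `H x = ∑ₐ Rₐ xᵃ` and `∂ᵢH (x) = ∑ₐ (aᵢ + 1) R_{a+eᵢ} xᵃ` on the cube.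
[Krantz–Parks 2002, Prop. 2.2.3, §2.2; folklore] -/
theorem stub_analyticOfSummable :
    ∀ (M : ℕ) (R : MvPowerSeries (Fin M) ℝ) (ρ : ℝ), 1 < ρ → Summable (fun a : Fin M →₀ ℕ => |MvPowerSeries.coeff a R| * ρ ^ (a.sum fun _ e => e)) → ∃ H : (Fin M → ℝ) → ℝ, AnalyticOnNhd ℝ H (KZ.cube M) ∧ (∀ x ∈ KZ.cube M, HasSum (fun a : Fin M →₀ ℕ => MvPowerSeries.coeff a R * a.prod (fun j e => x j ^ e)) (H x)) ∧ (∀ x ∈ KZ.cube M, ∀ i : Fin M, HasSum (fun a : Fin M →₀ ℕ => ((a i : ℝ) + 1) * MvPowerSeries.coeff (a + Finsupp.single i 1) R * a.prod (fun j e => x j ^ e)) (fderiv ℝ H x (Pi.single i 1))) := by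
  intro M R ρ hρ hR
  exact ⟨Literature.RingTheory.MvPowerSeries.eval R, aos_analyticOnNhd_eval hρ hR,
    fun x hx => aos_hasSum_eval hρ.le hR hx, fun x hx i => aos_hasSum_fderiv hρ hR hx i⟩

end Summit.KontsevichZagierPeriods.FurushoPentagon.SectorToKernel
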